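import Literature.Probability.Percolation.SlabCircuitFromLinks
import HarnessLib

/-!
# Newman–Tassion–Wu 2017, Theorem 3.10 — the closing step for the TRUNCATED corner links (the
# links actually produced by four successive corner gluings)

Topic: `Literature/Probability/Percolation`. Companion of `SlabCircuitFromLinks.lean` (p1 GEN 29,
port of THEOREM 3.10 of Newman–Tassion–Wu, CPAM 70 (2017), arXiv:1512.09107, pp. 12–14).  The
four corner gluings of the port are performed one after the other (NTW: "we now perform a two
step gluing procedure in the square regions `R₁` and `R₂`", p. 13); a later surgery clears edges in
its corner square, so the link produced at an earlier corner must not run through a later corner,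
and the minimal path glued at a corner must not run through an earlier one.  Hence the TRUNCATED
geometry of this file (hole `[-N,N]²`, `W = N+n+1`, rotation `ϱ(x,y) = (y,-x)`):

* `domT = [-N, W] × [N+1, N+n]` (the top side from the hole's left edge to the outer right column:
  domain of the top minimal path `Γ_T`, `A = {x = -N}`, `B = {x = W}`), `domR = ϱ(domT)`, `domB`,
  `domL`;
* `corR = [N+1, N+n] × [-N, W-1]` (the right side above the hole's bottom edge: the corridor of the
  path `κ_R` glued to `Γ_T` in the top-right corner), `corB = ϱ(corR)`, `corL`, `corT`;
* **`cornerLink₁ = {y = -N} ⟷^{domT ∪ corR} {x = -N}`** (= `C ⟷^R A`, the output of the top-right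
  gluing) and its rotations `cornerLink₂, cornerLink₃, cornerLink₄` — `cornerLinkᵢ` avoids the three
  other corner squares;
* the HUB STRIPS `hubT = [-N+1, N-1] × [N+1, N+n]`, … (strictly between the corner links' end
  lines) with their uniqueness events `hubUniqT = linked k hubT {x = -N+1} {x = N-1}`, ….

Main result: **`NTW17.circuitAround_of_cornerLinks`** — for a lattice configuration and `N ≥ 2`,
`cornerLink₁ ∩ … ∩ cornerLink₄ ∩ hubUniqT ∩ hubUniqR ∩ hubUniqB ∩ hubUniqL ⟹ circuitAround k 0 N (N+n+1)`
(same proof as `circuitAround_of_ringLinks`: crossing vertices by `exists_crossVertex`, strip links by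
`linked`, winding `1` by telescoping, `circuitAround_of_walkVal`).

## Sources

* C. M. Newman, V. Tassion, W. Wu, *Critical percolation and the minimal spanning tree in slabs*,
  Comm. Pure Appl. Math. 70 (2017) 2084–2120, arXiv:1512.09107: Theorem 3.10 and its proof
  (pp. 12–14) [NewmanTassionWu2017].
-/

noncomputable section

namespace Literature.Probability.Percolation

open LatticeModels

namespace NTW17

variable {k : ℕ}

/-! ## Truncated sides, corridors, corner links, hub strips -/

section Defs

variable (k) (N n : ℕ)

/-- `domT = [-N, N+n+1] × [N+1, N+n]`: the top side minus the top-left corner square (domain of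
`Γ_T`). [cite: NewmanTassionWu2017, Theorem 3.10 (proof, the regions S₁, S₁')] -/
def domT : Set (ℤ × ℤ) := boxR (-(N : ℤ)) ((N : ℤ) + n + 1) ((N : ℤ) + 1) ((N : ℤ) + n)

/-- `domR = ϱ(domT) = [N+1, N+n] × [-(N+n+1), N]`. [cite: NewmanTassionWu2017, Theorem 3.10 (proof, the regions S₂, S₂')] -/
def domR : Set (ℤ × ℤ) := boxR ((N : ℤ) + 1) ((N : ℤ) + n) (-((N : ℤ) + n + 1)) N

/-- `domB = ϱ²(domT) = [-(N+n+1), N] × [-N-n, -N-1]`. [cite: NewmanTassionWu2017, Theorem 3.10 (proof, the regions S₂, S₂')] -/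
def domB : Set (ℤ × ℤ) := boxR (-((N : ℤ) + n + 1)) N (-((N : ℤ) + n)) (-((N : ℤ) + 1))

/-- `domL = ϱ³(domT) = [-N-n, -N-1] × [-N, N+n+1]`. [cite: NewmanTassionWu2017, Theorem 3.10 (proof, the regions S₁, S₁')] -/
def domL : Set (ℤ × ℤ) := boxR (-((N : ℤ) + n)) (-((N : ℤ) + 1)) (-(N : ℤ)) ((N : ℤ) + n + 1)

/-- `corR = [N+1, N+n] × [-N, N+n]`: the right side above the hole's bottom edge (corridor of `κ_R`,
glued to `Γ_T` in the top-right corner). [cite: NewmanTassionWu2017, Theorem 3.10 (proof, the regions S₂, S₂')] -/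
def corR : Set (ℤ × ℤ) := boxR ((N : ℤ) + 1) ((N : ℤ) + n) (-(N : ℤ)) ((N : ℤ) + n)

/-- `corB = ϱ(corR) = [-N, N+n] × [-N-n, -N-1]`. [cite: NewmanTassionWu2017, Theorem 3.10 (proof)] -/
def corB : Set (ℤ × ℤ) := boxR (-(N : ℤ)) ((N : ℤ) + n) (-((N : ℤ) + n)) (-((N : ℤ) + 1))

/-- `corL = ϱ²(corR) = [-N-n, -N-1] × [-N-n, N]`. [cite: NewmanTassionWu2017, Theorem 3.10 (proof)] -/
def corL : Set (ℤ × ℤ) := boxR (-((N : ℤ) + n)) (-((N : ℤ) + 1)) (-((N : ℤ) + n)) N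

/-- `corT = ϱ³(corR) = [-N-n, N] × [N+1, N+n]`. [cite: NewmanTassionWu2017, Theorem 3.10 (proof)] -/
def corT : Set (ℤ × ℤ) := boxR (-((N : ℤ) + n)) N ((N : ℤ) + 1) ((N : ℤ) + n)

/-- **Corner link 1** (top-right): `{y = -N} ⟷^{domT ∪ corR} {x = -N}` — from the bottom row of the
right corridor, up and around the top-right corner, along the top side to the hole's left edge.
[cite: NewmanTassionWu2017, Theorem 3.10 (proof, (3.121)–(3.122))] -/
def cornerLink₁ : Set (BondConfig (slab 3 k)) :=
  slabConn k (domT N n ∪ corR N n) {z | z.2 = -(N : ℤ)} {z | z.1 = -(N : ℤ)}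

/-- **Corner link 2** (bottom-right, `= ϱ(cornerLink₁)`): `{x = -N} ⟷^{domR ∪ corB} {y = N}`.
[cite: NewmanTassionWu2017, Theorem 3.10 (proof, (3.121)–(3.122))] -/
def cornerLink₂ : Set (BondConfig (slab 3 k)) :=
  slabConn k (domR N n ∪ corB N n) {z | z.1 = -(N : ℤ)} {z | z.2 = (N : ℤ)}

/-- **Corner link 3** (bottom-left, `= ϱ²(cornerLink₁)`): `{y = N} ⟷^{domB ∪ corL} {x = N}`.
[cite: NewmanTassionWu2017, Theorem 3.10 (proof, (3.121)–(3.122))] -/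
def cornerLink₃ : Set (BondConfig (slab 3 k)) :=
  slabConn k (domB N n ∪ corL N n) {z | z.2 = (N : ℤ)} {z | z.1 = (N : ℤ)}

/-- **Corner link 4** (top-left, `= ϱ³(cornerLink₁)`): `{x = N} ⟷^{domL ∪ corT} {y = -N}`.
[cite: NewmanTassionWu2017, Theorem 3.10 (proof, (3.121)–(3.122))] -/
def cornerLink₄ : Set (BondConfig (slab 3 k)) :=
  slabConn k (domL N n ∪ corT N n) {z | z.1 = (N : ℤ)} {z | z.2 = -(N : ℤ)}

/-- The top hub strip `[-N+1, N-1] × [N+1, N+n]` (strictly between the end lines of the links).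
[cite: NewmanTassionWu2017, Theorem 3.10 (proof, the regions S₁, S₂)] -/
def hubT : Set (ℤ × ℤ) := boxR (-(N : ℤ) + 1) ((N : ℤ) - 1) ((N : ℤ) + 1) ((N : ℤ) + n)

/-- The right hub strip `[N+1, N+n] × [-N+1, N-1]`. [cite: NewmanTassionWu2017, Theorem 3.10 (proof, the regions S₁, S₂)] -/
def hubR : Set (ℤ × ℤ) := boxR ((N : ℤ) + 1) ((N : ℤ) + n) (-(N : ℤ) + 1) ((N : ℤ) - 1)

/-- The bottom hub strip `[-N+1, N-1] × [-N-n, -N-1]`. [cite: NewmanTassionWu2017, Theorem 3.10 (proof, the regions S₁, S₂)] -/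
def hubB : Set (ℤ × ℤ) := boxR (-(N : ℤ) + 1) ((N : ℤ) - 1) (-((N : ℤ) + n)) (-((N : ℤ) + 1))

/-- The left hub strip `[-N-n, -N-1] × [-N+1, N-1]`. [cite: NewmanTassionWu2017, Theorem 3.10 (proof, the regions S₁, S₂)] -/
def hubL : Set (ℤ × ℤ) := boxR (-((N : ℤ) + n)) (-((N : ℤ) + 1)) (-(N : ℤ) + 1) ((N : ℤ) - 1)

/-- `𝒰_T` for the top hub strip (ends `x = -N+1`, `x = N-1`). [cite: NewmanTassionWu2017, Theorem 3.10 (proof, the events 𝒰₁, 𝒰₂)] -/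
def hubUniqT : Set (BondConfig (slab 3 k)) := linked k (hubT N n) {z | z.1 = -(N : ℤ) + 1} {z | z.1 = (N : ℤ) - 1}

/-- `𝒰_R` for the right hub strip (ends `y = -N+1`, `y = N-1`). [cite: NewmanTassionWu2017, Theorem 3.10 (proof, the events 𝒰₁, 𝒰₂)] -/
def hubUniqR : Set (BondConfig (slab 3 k)) := linked k (hubR N n) {z | z.2 = -(N : ℤ) + 1} {z | z.2 = (N : ℤ) - 1}

/-- `𝒰_B` for the bottom hub strip. [cite: NewmanTassionWu2017, Theorem 3.10 (proof, the events 𝒰₁, 𝒰₂)] -/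
def hubUniqB : Set (BondConfig (slab 3 k)) := linked k (hubB N n) {z | z.1 = -(N : ℤ) + 1} {z | z.1 = (N : ℤ) - 1}

/-- `𝒰_L` for the left hub strip. [cite: NewmanTassionWu2017, Theorem 3.10 (proof, the events 𝒰₁, 𝒰₂)] -/
def hubUniqL : Set (BondConfig (slab 3 k)) := linked k (hubL N n) {z | z.2 = -(N : ℤ) + 1} {z | z.2 = (N : ℤ) - 1}

end Defs

/-! ## The closing theorem for corner links -/

section Closing

variable {N n : ℕ} {ω : BondConfig (slab 3 k)}

/-- The union of the four link regions. [folklore] -/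
private def hull (N n : ℕ) : Set (ℤ × ℤ) :=
  (domT N n ∪ corR N n) ∪ (domR N n ∪ corB N n) ∪ (domB N n ∪ corL N n) ∪ (domL N n ∪ corT N n)

/-- The hull lies in the annulus `A_{N, N+n+1}(0)`. [folklore] -/
private theorem hull_subset_annulus : hull N n ⊆ annulus (0, 0) N (N + n + 1) := by
  intro z hz
  simp only [hull, domT, corR, domR, corB, domB, corL, domL, corT, Set.mem_union, mem_boxR_iff] at hz
  rw [mem_annulus_iff]
  simp only [abs_le]
  push_cast
  omega

/-- Lifts of parts of the hull lie in the lifted annulus. [folklore] -/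
private theorem lift_sub' {Ω : Set (ℤ × ℤ)} (h : Ω ⊆ hull N n) :
    slabLift k Ω ⊆ slabLift k (annulus (0, 0) N (N + n + 1)) :=
  slabLift_mono k (h.trans hull_subset_annulus)

/-- The link regions and the hub strips are parts of the hull. [folklore] -/
private theorem parts_subset_hull :
    domT N n ∪ corR N n ⊆ hull N n ∧ domR N n ∪ corB N n ⊆ hull N n ∧
      domB N n ∪ corL N n ⊆ hull N n ∧ domL N n ∪ corT N n ⊆ hull N n ∧
      hubT N n ⊆ hull N n ∧ hubR N n ⊆ hull N n ∧ hubB N n ⊆ hull N n ∧ hubL N n ⊆ hull N n := by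
  refine ⟨?_, ?_, ?_, ?_, ?_, ?_, ?_, ?_⟩ <;> intro z hz <;>
    simp only [hull, Set.mem_union] at hz ⊢
  · tauto
  · tauto
  · tauto
  · tauto
  all_goals
    simp only [hubT, hubR, hubB, hubL, domT, corR, domR, corB, domB, corL, domL, corT, mem_boxR_iff] at hz ⊢
    omega

/-- Cut-row behaviour (cut rows `0`, `1`; `N ≥ 2`): the regions of links 1 and 2 and the right hub
strip meet the cut rows only in columns `≥ 1`. [folklore] -/
private theorem adm_regions' (hN : 2 ≤ N) :
    (∀ z ∈ domT N n ∪ corR N n, (z.2 = 0 ∨ z.2 = 1) → 1 ≤ z.1) ∧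
      (∀ z ∈ domR N n ∪ corB N n, (z.2 = 0 ∨ z.2 = 1) → 1 ≤ z.1) ∧
      (∀ z ∈ hubR N n, (z.2 = 0 ∨ z.2 = 1) → 1 ≤ z.1) := by
  refine ⟨?_, ?_, ?_⟩ <;> intro z hz h <;>
    simp only [Set.mem_union, domT, corR, domR, corB, hubR, mem_boxR_iff] at hz <;> omega

/-- Cut-row behaviour: the other regions meet the cut rows only in columns `≤ 0`. [folklore] -/
private theorem free_regions' (hN : 2 ≤ N) :
    (∀ z ∈ domL N n ∪ corT N n, (z.2 = 0 ∨ z.2 = 1) → z.1 ≤ 0) ∧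
      (∀ z ∈ domB N n ∪ corL N n, (z.2 = 0 ∨ z.2 = 1) → z.1 ≤ 0) ∧
      (∀ z ∈ hubT N n, (z.2 = 0 ∨ z.2 = 1) → z.1 ≤ 0) ∧
      (∀ z ∈ hubB N n, (z.2 = 0 ∨ z.2 = 1) → z.1 ≤ 0) ∧
      (∀ z ∈ hubL N n, (z.2 = 0 ∨ z.2 = 1) → z.1 ≤ 0) := by
  refine ⟨?_, ?_, ?_, ?_, ?_⟩ <;> intro z hz h <;>
    simp only [Set.mem_union, domL, corT, domB, corL, hubT, hubB, hubL, mem_boxR_iff] at hz <;> omega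

/-- The coordinate functionals `±x`, `±y` change by at most one along lattice steps. [folklore] -/
private theorem lip_coord' :
    (∀ z w : ℤ × ℤ, planarAdj z w → (fun z : ℤ × ℤ => z.2) w ≤ (fun z : ℤ × ℤ => z.2) z + 1) ∧
      (∀ z w : ℤ × ℤ, planarAdj z w → (fun z : ℤ × ℤ => -z.2) w ≤ (fun z : ℤ × ℤ => -z.2) z + 1) ∧
      (∀ z w : ℤ × ℤ, planarAdj z w → (fun z : ℤ × ℤ => z.1) w ≤ (fun z : ℤ × ℤ => z.1) z + 1) ∧
      (∀ z w : ℤ × ℤ, planarAdj z w → (fun z : ℤ × ℤ => -z.1) w ≤ (fun z : ℤ × ℤ => -z.1) z + 1) := by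
  refine ⟨fun z w h => ?_, fun z w h => ?_, fun z w h => ?_, fun z w h => ?_⟩ <;>
    have := abs_sub_le_one_of_planarAdj h <;> simp only <;> omega

/-- Any two vertices of an open self-avoiding path are joined inside its domain. [folklore] -/
private theorem conn_of_mem' {S X Y : Set (slab 3 k)} {l : List (slab 3 k)} (hl : IsOSAP k ω S X Y l)
    {a b : slab 3 k} (ha : a ∈ l) (hb : b ∈ l) : ω ∈ openConnIn S a b :=
  SlabCriticality.openConnIn_trans (openConnIn_reverse (hl.openConnIn_of_mem ha)) (hl.openConnIn_of_mem hb)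

/-- Corner link 1 crosses the right hub strip (bottom to top) and the top hub strip (right to left).
[cite: NewmanTassionWu2017, Theorem 3.10 (proof, the unique crossing clusters)] -/
private theorem cross_of_cornerLink₁ (hN : 2 ≤ N) (hω : ω ⊆ (slabGraph 3 k).edgeSet)
    (h₁ : ω ∈ cornerLink₁ k N n) :
    ∃ v₁ t₁ : slab 3 k, ω ∈ openConnIn (slabLift k (domT N n ∪ corR N n)) v₁ t₁ ∧
      (Reach k (hubR N n) {z | z.2 = -(N : ℤ) + 1} ω v₁ ∧ Reach k (hubR N n) {z | z.2 = (N : ℤ) - 1} ω v₁) ∧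
      (Reach k (hubT N n) {z | z.1 = -(N : ℤ) + 1} ω t₁ ∧ Reach k (hubT N n) {z | z.1 = (N : ℤ) - 1} ω t₁) ∧
      indUp (ts (0, 0)) (proj k t₁) = 1 := by
  obtain ⟨l, hl⟩ := (mem_slabConn_iff_exists_isOSAP ω _ _ _).1 h₁
  have eh := hl.head_mem hl.ne_nil; have el := hl.last_mem hl.ne_nil
  have rh := hl.subset _ (List.head_mem hl.ne_nil); have rl := hl.subset _ (List.getLast_mem hl.ne_nil)
  simp only [mem_slabLift_iff, Set.mem_setOf_eq, Set.mem_union, domT, corR, mem_boxR_iff] at eh el rh rl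
  have hNN : (-(N : ℤ) + 1) ≤ (N : ℤ) - 1 := by omega
  have hX : ∀ z ∈ l, planar k z ∈ domT N n ∪ corR N n := hl.subset
  obtain ⟨v, hvl, hvX, hvc, e, he, hve⟩ := exists_crossVertex hω lip_coord'.1 (X := hubR N n) hNN
    hl.ne_nil hl.chain (fun z hz h1 h2 => by
      have := hX z hz
      simp only [Set.mem_union, domT, corR, mem_boxR_iff] at this
      simp only [hubR, mem_boxR_iff]; omega) (by omega) (by omega)
  obtain ⟨t, htl, htX, htc, e', he', hte⟩ := exists_crossVertex hω lip_coord'.2.2.2 (X := hubT N n)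
    (c := -(N : ℤ) + 1) (d := (N : ℤ) - 1) hNN hl.ne_nil hl.chain (fun z hz h1 h2 => by
      have := hX z hz
      simp only [Set.mem_union, domT, corR, mem_boxR_iff] at this
      simp only [hubT, mem_boxR_iff]; omega) (by omega) (by omega)
  refine ⟨v, t, conn_of_mem' hl hvl htl, ⟨⟨v, ?_, openConnIn_refl (by simpa using hvX)⟩, ⟨e, ?_, hve⟩⟩,
    ⟨⟨e', ?_, hte⟩, ⟨t, ?_, openConnIn_refl (by simpa using htX)⟩⟩, ?_⟩
  · simp only [mem_slabLift_iff, Set.mem_setOf_eq]; omega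
  · simp only [mem_slabLift_iff, Set.mem_setOf_eq]; omega
  · simp only [mem_slabLift_iff, Set.mem_setOf_eq]; omega
  · simp only [mem_slabLift_iff, Set.mem_setOf_eq]; omega
  · simp only [hubT, mem_boxR_iff] at htX
    simp only [indUp, proj_apply_one, ts_apply_one, zero_add]; split_ifs <;> omega

/-- Corner link 2 crosses the bottom hub strip (left to right) and the right hub strip (bottom to
top). [cite: NewmanTassionWu2017, Theorem 3.10 (proof, the unique crossing clusters)] -/
private theorem cross_of_cornerLink₂ (hN : 2 ≤ N) (hω : ω ⊆ (slabGraph 3 k).edgeSet)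
    (h₂ : ω ∈ cornerLink₂ k N n) :
    ∃ b₂ v₂ : slab 3 k, ω ∈ openConnIn (slabLift k (domR N n ∪ corB N n)) b₂ v₂ ∧
      (Reach k (hubB N n) {z | z.1 = -(N : ℤ) + 1} ω b₂ ∧ Reach k (hubB N n) {z | z.1 = (N : ℤ) - 1} ω b₂) ∧
      (Reach k (hubR N n) {z | z.2 = -(N : ℤ) + 1} ω v₂ ∧ Reach k (hubR N n) {z | z.2 = (N : ℤ) - 1} ω v₂) ∧
      indUp (ts (0, 0)) (proj k b₂) = 0 := by
  obtain ⟨l, hl⟩ := (mem_slabConn_iff_exists_isOSAP ω _ _ _).1 h₂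
  have eh := hl.head_mem hl.ne_nil; have el := hl.last_mem hl.ne_nil
  have rh := hl.subset _ (List.head_mem hl.ne_nil); have rl := hl.subset _ (List.getLast_mem hl.ne_nil)
  simp only [mem_slabLift_iff, Set.mem_setOf_eq, Set.mem_union, domR, corB, mem_boxR_iff] at eh el rh rl
  have hNN : (-(N : ℤ) + 1) ≤ (N : ℤ) - 1 := by omega
  have hX : ∀ z ∈ l, planar k z ∈ domR N n ∪ corB N n := hl.subset
  obtain ⟨b, hbl, hbX, hbc, e, he, hbe⟩ := exists_crossVertex hω lip_coord'.2.2.1 (X := hubB N n) hNN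
    hl.ne_nil hl.chain (fun z hz h1 h2 => by
      have := hX z hz
      simp only [Set.mem_union, domR, corB, mem_boxR_iff] at this
      simp only [hubB, mem_boxR_iff]; omega) (by omega) (by omega)
  obtain ⟨v, hvl, hvX, hvc, e', he', hve⟩ := exists_crossVertex hω lip_coord'.1 (X := hubR N n) hNN
    hl.ne_nil hl.chain (fun z hz h1 h2 => by
      have := hX z hz
      simp only [Set.mem_union, domR, corB, mem_boxR_iff] at this
      simp only [hubR, mem_boxR_iff]; omega) (by omega) (by omega)
  refine ⟨b, v, conn_of_mem' hl hbl hvl, ⟨⟨b, ?_, openConnIn_refl (by simpa using hbX)⟩, ⟨e, ?_, hbe⟩⟩,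
    ⟨⟨v, ?_, openConnIn_refl (by simpa using hvX)⟩, ⟨e', ?_, hve⟩⟩, ?_⟩
  · simp only [mem_slabLift_iff, Set.mem_setOf_eq]; omega
  · simp only [mem_slabLift_iff, Set.mem_setOf_eq]; omega
  · simp only [mem_slabLift_iff, Set.mem_setOf_eq]; omega
  · simp only [mem_slabLift_iff, Set.mem_setOf_eq]; omega
  · simp only [hubB, mem_boxR_iff] at hbX
    simp only [indUp, proj_apply_one, ts_apply_one, zero_add]; split_ifs <;> omega

/-- Corner link 3 crosses the left hub strip (top to bottom) and the bottom hub strip (left to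
right). [cite: NewmanTassionWu2017, Theorem 3.10 (proof, the unique crossing clusters)] -/
private theorem cross_of_cornerLink₃ (hN : 2 ≤ N) (hω : ω ⊆ (slabGraph 3 k).edgeSet)
    (h₃ : ω ∈ cornerLink₃ k N n) :
    ∃ s₃ b₃ : slab 3 k, ω ∈ openConnIn (slabLift k (domB N n ∪ corL N n)) s₃ b₃ ∧
      (Reach k (hubL N n) {z | z.2 = -(N : ℤ) + 1} ω s₃ ∧ Reach k (hubL N n) {z | z.2 = (N : ℤ) - 1} ω s₃) ∧
      (Reach k (hubB N n) {z | z.1 = -(N : ℤ) + 1} ω b₃ ∧ Reach k (hubB N n) {z | z.1 = (N : ℤ) - 1} ω b₃) := by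
  obtain ⟨l, hl⟩ := (mem_slabConn_iff_exists_isOSAP ω _ _ _).1 h₃
  have eh := hl.head_mem hl.ne_nil; have el := hl.last_mem hl.ne_nil
  have rh := hl.subset _ (List.head_mem hl.ne_nil); have rl := hl.subset _ (List.getLast_mem hl.ne_nil)
  simp only [mem_slabLift_iff, Set.mem_setOf_eq, Set.mem_union, domB, corL, mem_boxR_iff] at eh el rh rl
  have hNN : (-(N : ℤ) + 1) ≤ (N : ℤ) - 1 := by omega
  have hX : ∀ z ∈ l, planar k z ∈ domB N n ∪ corL N n := hl.subset
  obtain ⟨s, hsl, hsX, hsc, e, he, hse⟩ := exists_crossVertex hω lip_coord'.2.1 (X := hubL N n)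
    (c := -(N : ℤ) + 1) (d := (N : ℤ) - 1) hNN hl.ne_nil hl.chain (fun z hz h1 h2 => by
      have := hX z hz
      simp only [Set.mem_union, domB, corL, mem_boxR_iff] at this
      simp only [hubL, mem_boxR_iff]; omega) (by omega) (by omega)
  obtain ⟨b, hbl, hbX, hbc, e', he', hbe⟩ := exists_crossVertex hω lip_coord'.2.2.1 (X := hubB N n) hNN
    hl.ne_nil hl.chain (fun z hz h1 h2 => by
      have := hX z hz
      simp only [Set.mem_union, domB, corL, mem_boxR_iff] at this
      simp only [hubB, mem_boxR_iff]; omega) (by omega) (by omega)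
  refine ⟨s, b, conn_of_mem' hl hsl hbl, ⟨⟨e, ?_, hse⟩, ⟨s, ?_, openConnIn_refl (by simpa using hsX)⟩⟩,
    ⟨⟨b, ?_, openConnIn_refl (by simpa using hbX)⟩, ⟨e', ?_, hbe⟩⟩⟩
  · simp only [mem_slabLift_iff, Set.mem_setOf_eq]; omega
  · simp only [mem_slabLift_iff, Set.mem_setOf_eq]; omega
  · simp only [mem_slabLift_iff, Set.mem_setOf_eq]; omega
  · simp only [mem_slabLift_iff, Set.mem_setOf_eq]; omega

/-- Corner link 4 crosses the top hub strip (right to left) and the left hub strip (top to bottom).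
[cite: NewmanTassionWu2017, Theorem 3.10 (proof, the unique crossing clusters)] -/
private theorem cross_of_cornerLink₄ (hN : 2 ≤ N) (hω : ω ⊆ (slabGraph 3 k).edgeSet)
    (h₄ : ω ∈ cornerLink₄ k N n) :
    ∃ t₄ s₄ : slab 3 k, ω ∈ openConnIn (slabLift k (domL N n ∪ corT N n)) t₄ s₄ ∧
      (Reach k (hubT N n) {z | z.1 = -(N : ℤ) + 1} ω t₄ ∧ Reach k (hubT N n) {z | z.1 = (N : ℤ) - 1} ω t₄) ∧
      (Reach k (hubL N n) {z | z.2 = -(N : ℤ) + 1} ω s₄ ∧ Reach k (hubL N n) {z | z.2 = (N : ℤ) - 1} ω s₄) := by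
  obtain ⟨l, hl⟩ := (mem_slabConn_iff_exists_isOSAP ω _ _ _).1 h₄
  have eh := hl.head_mem hl.ne_nil; have el := hl.last_mem hl.ne_nil
  have rh := hl.subset _ (List.head_mem hl.ne_nil); have rl := hl.subset _ (List.getLast_mem hl.ne_nil)
  simp only [mem_slabLift_iff, Set.mem_setOf_eq, Set.mem_union, domL, corT, mem_boxR_iff] at eh el rh rl
  have hNN : (-(N : ℤ) + 1) ≤ (N : ℤ) - 1 := by omega
  have hX : ∀ z ∈ l, planar k z ∈ domL N n ∪ corT N n := hl.subset
  obtain ⟨t, htl, htX, htc, e, he, hte⟩ := exists_crossVertex hω lip_coord'.2.2.2 (X := hubT N n)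
    (c := -(N : ℤ) + 1) (d := (N : ℤ) - 1) hNN hl.ne_nil hl.chain (fun z hz h1 h2 => by
      have := hX z hz
      simp only [Set.mem_union, domL, corT, mem_boxR_iff] at this
      simp only [hubT, mem_boxR_iff]; omega) (by omega) (by omega)
  obtain ⟨s, hsl, hsX, hsc, e', he', hse⟩ := exists_crossVertex hω lip_coord'.2.1 (X := hubL N n)
    (c := -(N : ℤ) + 1) (d := (N : ℤ) - 1) hNN hl.ne_nil hl.chain (fun z hz h1 h2 => by
      have := hX z hz
      simp only [Set.mem_union, domL, corT, mem_boxR_iff] at this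
      simp only [hubL, mem_boxR_iff]; omega) (by omega) (by omega)
  refine ⟨t, s, conn_of_mem' hl htl hsl, ⟨⟨e, ?_, hte⟩, ⟨t, ?_, openConnIn_refl (by simpa using htX)⟩⟩,
    ⟨⟨e', ?_, hse⟩, ⟨s, ?_, openConnIn_refl (by simpa using hsX)⟩⟩⟩
  · simp only [mem_slabLift_iff, Set.mem_setOf_eq]; omega
  · simp only [mem_slabLift_iff, Set.mem_setOf_eq]; omega
  · simp only [mem_slabLift_iff, Set.mem_setOf_eq]; omega
  · simp only [mem_slabLift_iff, Set.mem_setOf_eq]; omega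

/-- **NTW Theorem 3.10, the closing step for the corner links produced by successive gluings.**
For a lattice configuration `ω` and `N ≥ 2`: if the four truncated corner links
`cornerLink₁, …, cornerLink₄` hold and the crossing clusters of the four hub strips are unique
(`hubUniqT, …, hubUniqL`), then `ω ∈ circuitAround k 0 N (N+n+1)`.
[cite: NewmanTassionWu2017, Theorem 3.10 (proof, pp. 13–14: "would imply the existence of a circuit in Ā")] -/
theorem circuitAround_of_cornerLinks (hN : 2 ≤ N) (hω : ω ⊆ (slabGraph 3 k).edgeSet)
    (h₁ : ω ∈ cornerLink₁ k N n) (h₂ : ω ∈ cornerLink₂ k N n) (h₃ : ω ∈ cornerLink₃ k N n)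
    (h₄ : ω ∈ cornerLink₄ k N n) (uT : ω ∈ hubUniqT k N n) (uR : ω ∈ hubUniqR k N n)
    (uB : ω ∈ hubUniqB k N n) (uL : ω ∈ hubUniqL k N n) :
    ω ∈ circuitAround k (0, 0) N (N + n + 1) := by
  obtain ⟨v₁, t₁, p₁, Rv₁, Rt₁, it₁⟩ := cross_of_cornerLink₁ hN hω h₁
  obtain ⟨b₂, v₂, p₂, Rb₂, Rv₂, ib₂⟩ := cross_of_cornerLink₂ hN hω h₂
  obtain ⟨s₃, b₃, p₃, Rs₃, Rb₃⟩ := cross_of_cornerLink₃ hN hω h₃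
  obtain ⟨t₄, s₄, p₄, Rt₄, Rs₄⟩ := cross_of_cornerLink₄ hN hω h₄
  have linkR : ω ∈ openConnIn (slabLift k (hubR N n)) v₂ v₁ := uR v₂ v₁ Rv₂.1 Rv₂.2 Rv₁.1 Rv₁.2
  have linkT : ω ∈ openConnIn (slabLift k (hubT N n)) t₁ t₄ := uT t₁ t₄ Rt₁.1 Rt₁.2 Rt₄.1 Rt₄.2
  have linkB : ω ∈ openConnIn (slabLift k (hubB N n)) b₃ b₂ := uB b₃ b₂ Rb₃.1 Rb₃.2 Rb₂.1 Rb₂.2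
  have linkL : ω ∈ openConnIn (slabLift k (hubL N n)) s₄ s₃ := uL s₄ s₃ Rs₄.1 Rs₄.2 Rs₃.1 Rs₃.2
  obtain ⟨adm₁, adm₂, admR⟩ := adm_regions' (n := n) hN
  obtain ⟨free₄, free₃, freeT, freeB, freeL⟩ := free_regions' (n := n) hN
  obtain ⟨s₁, s₂, s₃', s₄', sT, sR, sB, sL⟩ := (parts_subset_hull : _ ∧ _ ∧ _ ∧ _ ∧ hubT N n ⊆ _ ∧ _)
  have W₁ := walkVal_of_openConnIn_right hω adm₁ (lift_sub' s₁) p₁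
  have W₂ := walkVal_of_openConnIn_left freeT (lift_sub' sT) linkT
  have W₃ := walkVal_of_openConnIn_left free₄ (lift_sub' s₄') p₄
  have W₄ := walkVal_of_openConnIn_left freeL (lift_sub' sL) linkL
  have W₅ := walkVal_of_openConnIn_left free₃ (lift_sub' s₃') p₃
  have W₆ := walkVal_of_openConnIn_left freeB (lift_sub' sB) linkB
  have W₇ := walkVal_of_openConnIn_right hω adm₂ (lift_sub' s₂) p₂
  have W₈ := walkVal_of_openConnIn_right hω admR (lift_sub' sR) linkR
  refine circuitAround_of_walkVal (((((((W₁.trans W₂).trans W₃).trans W₄).trans W₅).trans W₆).trans W₇).trans W₈) ?_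
  rw [it₁, ib₂]
  omega

end Closing

end NTW17

end Literature.Probability.Percolation

end
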